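/-
Copyright (c) 2026. All rights reserved.
Released under Apache 2.0 license as described in the file LICENSE.
Authors: abc-iut cell, prover seat abc-iut-L4-d2 (gen 6).
-/
import Literature.AnabelianGeometry.AbsoluteAnabelian.GaloisTheatersNumberFieldShadowTPairs
import Literature.AnabelianGeometry.AbsoluteAnabelian.GlobalKummerMapsInjectiveProofs
import Literature.AnabelianGeometry.AbsoluteAnabelian.NumberFieldGlobalKummerInjectiveProofs
import HarnessLib

/-!
# [AbsTopIII] Cor 5.2 (iii), the `↪` (F-3956 `Cor52iiiKummerInjective`) PROVED at the number-field shadow vocabulary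

S. Mochizuki, *Topics in absolute anabelian geometry III* [MochizukiAbsTopIII2015], Cor 5.2 (iii) p. 119: for a global
`T`-pair (`T ∈ {TF, TM}`) the Kummer map `M⊚_TLG → lim_{→J} H¹(J, μ_Ẑ(M⊚_TM))` is INJECTIVE.  The cell's named fact
`Cor52iiiKummerInjective W hT C` (`GlobalKummerMaps.lean`; universal closure refuted in
`GlobalKummerMapsCarrierNonVacuity.lean`) was reduced (`GlobalKummerMapsInjectiveProofs.lean`, abc-iut-w6-d033) to a
level-wise no-divisible-elements statement.

THIS PROOF-ONLY FILE proves it for the `TM`-pair vocabulary of the number-field shadow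
(`GaloisTheatersNumberFieldShadowTPairs.lean`, abc-iut-L4-d2 g6: `M_{TLG}(Π) = ℚ̄ˣ` with `Π` acting through its `ℚ`-chart;
underlying groups = the objects):

* `isOpen_map_ratChart_of_isAdmissible` — the chart of an admissible `Π` carries open subgroups to open subgroups of `G_ℚ`;
* **`cor52iiiKummerInjective_shadow : Cor52iiiKummerInjective (shadowVocabulary F) _ (shadowCarrier F)`** — for EVERY
  global `TM`-pair `P` over the shadow the global Kummer map `|M⊚| → lim_{→J} H¹(J, Λ|M⊚|)` is injective: through the
  `Π`-equivariant reference isomorphism `ψ⊚ : ℚ̄ˣ ≅ M⊚`, a `J`-invariant element with `J`-invariant `n`-th roots for all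
  `n` is a unit of the number field fixed by the OPEN subgroup `ratChart(J) ≤ G_ℚ`, infinitely divisible there, hence
  `1` (abc-iut-L4-d2 g4's `units_eq_one_of_fixed_of_forall_exists_fixed_pow`, [AbsTopIII] Def 1.5 / Rmk 1.5.3 (i) for
  number fields);
* `shadowGlobalTPair_kummer_injective` — in particular the Kummer map of the CANONICAL global `TM`-pair `M⊚_TM(E_F)`
  (`shadowGlobalTPair F`, so the `∀ P` is not vacuous) is injective.

HONEST LABEL: «instance PROVED at the number-field SHADOW vocabulary» (`Δ = 1`; genuine global Galois data `ℚ̄ˣ`, stub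
local/archimedean/cyclotomic structure) — NOT print's `T`-pairs of an elliptically admissible curve (E-L4-13); classical;
nothing here bears on [IUTchIII] Cor. 3.12 or takes a side; typed ≠ proved elsewhere.
-/

noncomputable section

open scoped Pointwise Topology
open CategoryTheory NumberField Field

namespace Literature.AnabelianGeometry.AbsoluteAnabelian

namespace NumberFieldShadow

variable (F : Type) [Field F] [NumberField F]

/-- The `ℚ`-chart of an ADMISSIBLE `Π_E` carries open subgroups of `Π_E` to open subgroups of `G_ℚ` (it is injective with
open range). [cite: MochizukiAbsTopIII2015, Def 5.1 (iii) p.115] -/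
theorem isOpen_map_ratChart_of_isAdmissible {E : FundamentalExtension.{0}} (hE : IsAdmissible F E)
    (J : Subgroup E.arith) (hJ : IsOpen (J : Set E.arith)) :
    IsOpen ((J.map (ratChart E).toMonoidHom : Subgroup (absoluteGaloisGroup ℚ)) : Set (absoluteGaloisGroup ℚ)) := by
  rw [Subgroup.coe_map]
  have hr : IsOpen ((ratChart E) '' ((⊤ : Subgroup E.arith) : Set E.arith)) := by
    rw [Subgroup.coe_top, Set.image_univ]
    have hr' := isOpen_range_ratChart_of_isAdmissible F hE
    rw [MonoidHom.coe_range] at hr'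
    exact hr'
  exact VirtualChart.isOpen_image_of_le (ratChart E) (W := ⊤) isOpen_univ
    (ratChart_injective_of_isAdmissible F hE).injOn hr hJ le_top

/-- `TM ≠ TLG`. [cite: MochizukiAbsTopIII2015, Def 5.1 (v) p.116] -/
theorem tm_ne_tlg : TKind.TM ≠ TKind.TLG := fun h => TKind.noConfusion h

/-- **[AbsTopIII] Cor 5.2 (iii), the `↪` (F-3956), PROVED at the number-field shadow vocabulary**: for every global
`TM`-pair over the shadow, the global Kummer map `M⊚_TLG → lim_{→J} H¹(J, μ_Ẑ(M⊚_TM))` is injective.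
[cite: MochizukiAbsTopIII2015, Cor 5.2 (iii) p.119] -/
theorem cor52iiiKummerInjective_shadow :
    Cor52iiiKummerInjective (shadowVocabulary F) tm_ne_tlg (shadowCarrier F) := by
  intro P
  refine (shadowCarrier F).globalKummerMap_injective_of P fun J a ha hroots => ?_
  have hE : IsAdmissible F P.theater.ext := P.theater.isAdmissible
  obtain ⟨ψ, hψ⟩ := exists_equivariant_iso_of_globalTPair F P
  let e : (AlgebraicClosure ℚ)ˣ ≃* (show CommGrpCat.{0} from P.M) := ψ.commGroupIsoToMulEquiv
  have he : ∀ x, e x = ψ.hom.hom x := fun _ => rfl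
  have hax : a = e (e.symm a) := (e.apply_symm_apply a).symm
  have hJ' := isOpen_map_ratChart_of_isAdmissible F hE (J : Subgroup P.theater.grp) J.isOpen
  have key : e.symm a = 1 := by
    refine units_eq_one_of_fixed_of_forall_exists_fixed_pow ℚ
      ((J : Subgroup P.theater.grp).map (ratChart P.theater.ext).toMonoidHom) hJ' (e.symm a) ?_ ?_
    · rintro _ ⟨u, hu, rfl⟩
      apply e.injective
      change e (ratChart P.theater.ext u • e.symm a) = _
      rw [he, hψ u, ← he, e.apply_symm_apply]
      exact ha u hu
    · intro n hn
      obtain ⟨b, hb, hbn⟩ := hroots n hn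
      refine ⟨e.symm b, ?_, ?_⟩
      · rintro _ ⟨u, hu, rfl⟩
        apply e.injective
        change e (ratChart P.theater.ext u • e.symm b) = _
        rw [he, hψ u, ← he, e.apply_symm_apply]
        exact hb u hu
      · apply e.injective
        rw [map_pow, e.apply_symm_apply, e.apply_symm_apply]
        exact hbn
  rw [hax, key]
  exact map_one e

/-- **The global Kummer map of `M⊚_TM(E_F)` — `ℚ̄ˣ → lim_{→J} H¹(J, Λ(ℚ̄ˣ))` over the open subgroups `J ≤ G_F` — is
injective** (Cor 5.2 (iii) `↪` at the canonical pair). [cite: MochizukiAbsTopIII2015, Cor 5.2 (iii) p.119] -/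
theorem shadowGlobalTPair_kummer_injective :
    Function.Injective ((shadowCarrier F).globalKummerMap (shadowGlobalTPair F)) :=
  cor52iiiKummerInjective_shadow F (shadowGlobalTPair F)

end NumberFieldShadow

end Literature.AnabelianGeometry.AbsoluteAnabelian

end
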